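import Literature.AlgebraicGeometry.AbelianSchemes.AbelianSchemeHomDescentFlatSurjective
import Literature.AlgebraicGeometry.Motives.AlbaneseByMaximality
import Literature.AlgebraicGeometry.Motives.AbelianVarietyKernelDimension
import Literature.AlgebraicGeometry.Motives.AbelianVarietyIsogenyProofs
import HarnessLib

/-!
# Descent of a homomorphism of abelian varieties through an isogeny, and recognition of the quotient by degree
([MumfordAV1970] §7 Thm. 4)

Topic `Literature/AlgebraicGeometry/Motives`, namespace `Literature.AlgebraicGeometry.Motives.AbelianVariety`.  THEOREMS ONLY (no definition, no
named fact, no instance, no notation, no `sorry`).  Cell `pub/hodgecm-mathlib` (D-0151 ∕ D-0183 floor 0), P6 «MOD programme», sub-line P6c «DICT»: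
organ **(o-c3k′)** = the `Motives.AbelianVariety`-CURRENCY face of ★ (o-c3k) `AbelianSchemes/AbelianSchemeHomDescentFlatSurjective` (descent
through an arbitrary flat surjective quasi-compact homomorphism over any base + recognition by rank), in the currency in which the HEART (c3b) ∕
(c3c) and GEN's `transl` ∕ `hecke` compute degrees (`Hom.kerRank`, ★ `IsIsogeny.kerRank_comp`, ★ `kerRank_relFrobenius`; sibling for the
`ker F` branch: ★ `AbelianVarietyRelFrobeniusFactorIso.isIso_of_relFrobenius_comp_eq`, where the factorisation is GIVEN — here it is PRODUCED).
Generic, count-neutral capital `--supports stmt-HodgeConjecture-24832`.  HONEST LABEL: HC_CM is proved only modulo the printed citations until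
rung 0 closes; this file pays no letter.

For abelian varieties `A B C` over a field `k`, an ISOGENY `f : A ⟶ C` and a homomorphism `g : A ⟶ B` KILLING `ker f` on points
(`hker : ∀ T (t : T ⟶ A.X), t ≫ f = 1 → t ≫ g = 1`, `T` any `k`-scheme, composites of the underlying `Over (Spec k)`-morphisms):

* **`IsIsogeny.existsUnique_comp_eq_of_forall_comp_eq_one`** — `∃! χ : C ⟶ B, f ≫ χ = g` (★ (o-c3k) on the records `ofAbelianVariety _ |>.toOver`,
  whose underlying group objects are those of `A B C` definitionally; the descended `Over`-morphism is a homomorphism, ★ `isMonHom_of_comp_eq`);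
* `isIsogeny_of_isIsogeny_comp_eq` — if also `g` is an isogeny, every factor `χ` (`f ≫ χ = g`) is an isogeny; `kerRank_eq_mul_of_comp_eq` —
  `deg g = deg f · deg χ` (★ `IsIsogeny.kerRank_comp`); **`isIso_of_comp_eq_of_kerRank_eq`** — if `deg f = deg g` then `χ` is an ISOMORPHISM
  (★ `IsIsogeny.isIso_of_kerRank_eq_one`);
* **`IsIsogeny.exists_iso_comp_eq_of_kerRank_eq`** — the package «two isogenies out of `A` of the same degree, the second killing the kernel of
  the first, are isomorphic under `A`, uniquely»: `∃ e : C ≅ B, f ≫ e.hom = g ∧ ∀ χ, f ≫ χ = g → χ = e.hom`; and then each kills the other's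
  kernel (`comp_eq_one_iff_of_iso_comp_eq`).
* §4 (ED. 2) EQUIVARIANCE: `IsIsogeny.comp_factor_eq_factor_comp` (functoriality of the factor in intertwined triples), `…_of_endo`,
  `IsIsogeny.comp_iso_eq_iso_comp_of_endo` (the recognition iso commutes with intertwined endomorphisms, e.g. `𝒪`-actions).

## References
* [MumfordAV1970] D. Mumford, *Abelian Varieties* (1970), §7 Thm. 4 (p. 72) (isogenies `f : X → Y` ↔ finite subgroups `K = ker f`; a homomorphism
  killing `ker f` factors uniquely through `f`).
* [Milne1986AbelianVarieties] J. S. Milne, *Abelian Varieties* (1986), §8 (p. 115) (`deg (g ∘ f) = deg g · deg f`).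
* [SGA1] A. Grothendieck, *SGA 1*, Exp. VIII Thm. 5.2 (fpqc descent of morphisms).
-/

noncomputable section

universe u

open CategoryTheory CategoryTheory.Limits AlgebraicGeometry MonoidalCategory CartesianMonoidalCategory
open scoped MonObj

namespace Literature.AlgebraicGeometry.Motives.AbelianVariety

open Literature.AlgebraicGeometry.AbelianSchemes

variable {k : Type u} [Field k] {A B C : AbelianVariety k}

/-! ## §1 Descent through an isogeny -/

/-- **DESCENT OF A HOMOMORPHISM THROUGH AN ISOGENY** ([MumfordAV1970] §7 Thm. 4): for an isogeny `f : A ⟶ C` and a homomorphism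
`g : A ⟶ B` of abelian varieties over a field with `g` killing `ker f` on points, there is a UNIQUE `χ : C ⟶ B` with `f ≫ χ = g`
(★ (o-c3k) `AbelianSchemeOver.existsUnique_comp_eq_of_forall_comp_eq_one`: `f` is finite, flat, surjective, hence an effective epimorphism
of schemes, and the descended morphism is a homomorphism). [cite: MumfordAV1970, §7 Thm. 4 (p. 72)] [cite: SGA1, Exp. VIII Thm. 5.2] -/
theorem IsIsogeny.existsUnique_comp_eq_of_forall_comp_eq_one {f : A ⟶ C} (hf : IsIsogeny f) (g : A ⟶ B)
    (hker : ∀ ⦃T : SchemeOver k⦄ (t : T ⟶ A.X), t ≫ f.hom.hom.hom = 1 → t ≫ g.hom.hom.hom = 1) :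
    ∃! χ : C ⟶ B, f ≫ χ = g := by
  -- the same group objects of `Over (Spec k)`, read as records of ★ `AbelianSchemeOver (Spec k)`
  let A' : AbelianSchemeOver (Spec (.of k)) := (AbelianScheme.ofAbelianVariety A).toOver
  let B' : AbelianSchemeOver (Spec (.of k)) := (AbelianScheme.ofAbelianVariety B).toOver
  let C' : AbelianSchemeOver (Spec (.of k)) := (AbelianScheme.ofAbelianVariety C).toOver
  let ψ : A'.X ⟶ C'.X := f.hom.hom.hom
  let φ : A'.X ⟶ B'.X := g.hom.hom.hom
  haveI : IsMonHom ψ := (inferInstance : IsMonHom f.hom.hom.hom)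
  haveI : IsMonHom φ := (inferInstance : IsMonHom g.hom.hom.hom)
  haveI : Surjective ψ.left := hf.1
  haveI : IsFinite ψ.left := hf.2
  haveI : Flat ψ.left := hf.flat
  obtain ⟨χ₀, hχ₀, huniq⟩ := A'.existsUnique_comp_eq_of_forall_comp_eq_one ψ φ hker
  haveI hχ₀m : IsMonHom χ₀ := A'.isMonHom_of_comp_eq ψ φ hχ₀
  haveI : @IsMonHom _ _ _ C.X B.X _ _ χ₀ := hχ₀m
  refine ⟨InducedCategory.homMk (Grp.homMk (A := C.toGrp) (B := B.toGrp) χ₀), hom_ext _ _ hχ₀, fun χ' hχ' => hom_ext _ _ ?_⟩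
  exact huniq χ'.hom.hom.hom (congrArg (fun e : A ⟶ B => e.hom.hom.hom) hχ')

/-- Conversely a composite `f ≫ χ` kills `ker f` on points (no hypothesis). [cite: MumfordAV1970, §7 Thm. 4 (p. 72)] -/
theorem comp_eq_one_of_comp_eq {f : A ⟶ C} {g : A ⟶ B} {χ : C ⟶ B} (hχ : f ≫ χ = g) {T : SchemeOver k} (t : T ⟶ A.X)
    (ht : t ≫ f.hom.hom.hom = 1) : t ≫ g.hom.hom.hom = 1 := by
  rw [← hχ, comp_hom]
  change t ≫ (f.hom.hom.hom ≫ χ.hom.hom.hom) = 1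
  rw [← Category.assoc, ht, MonObj.one_comp]

/-! ## §2 Factors of an isogeny through an isogeny: isogeny, degree, isomorphism -/

/-- **A factor of an isogeny through an isogeny is an isogeny**: if `f ≫ χ = g` with `f`, `g` isogenies then `χ` is surjective (as `g`
is) between abelian varieties of the same dimension (`dim C = dim A = dim B`), hence an isogeny (★ `isIsogeny_of_surjective_of_dim_eq`).
[cite: MumfordAV1970, §7 Thm. 4 (p. 72)] -/
theorem isIsogeny_of_isIsogeny_comp_eq {f : A ⟶ C} {g : A ⟶ B} (hf : IsIsogeny f) (hg : IsIsogeny g) {χ : C ⟶ B}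
    (hχ : f ≫ χ = g) : IsIsogeny χ := by
  haveI : Surjective (Hom.toSchemeHom f ≫ Hom.toSchemeHom χ) := by
    have e : Hom.toSchemeHom f ≫ Hom.toSchemeHom χ = Hom.toSchemeHom g := by rw [← hχ]; rfl
    rw [e]
    exact hg.1
  haveI : Surjective (Hom.toSchemeHom χ) := Surjective.of_comp (Hom.toSchemeHom f) _
  exact isIsogeny_of_surjective_of_dim_eq χ ((dim_eq_of_isIsogeny hf).symm.trans (dim_eq_of_isIsogeny hg))

/-- **Degrees multiply along a factorisation**: `f ≫ χ = g` with `f`, `g` isogenies gives `deg g = deg f · deg χ` (★ `IsIsogeny.kerRank_comp`).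
[cite: Milne1986AbelianVarieties, §8 (p. 115)] -/
theorem kerRank_eq_mul_of_comp_eq {f : A ⟶ C} {g : A ⟶ B} (hf : IsIsogeny f) (hg : IsIsogeny g) {χ : C ⟶ B} (hχ : f ≫ χ = g) :
    Hom.kerRank g = Hom.kerRank f * Hom.kerRank χ := by
  rw [← hχ]
  exact hf.kerRank_comp (isIsogeny_of_isIsogeny_comp_eq hf hg hχ)

/-- **RECOGNITION BY DEGREE**: a factor `χ` of an isogeny `g` through an isogeny `f` OF THE SAME DEGREE is an ISOMORPHISM (`deg f = deg f · deg χ`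
with `deg f ≠ 0` gives `deg χ = 1`, ★ `IsIsogeny.isIso_of_kerRank_eq_one`). [cite: MumfordAV1970, §7 Thm. 4 (p. 72)]
[cite: Milne1986AbelianVarieties, §8 (p. 115)] -/
theorem isIso_of_comp_eq_of_kerRank_eq {f : A ⟶ C} {g : A ⟶ B} (hf : IsIsogeny f) (hg : IsIsogeny g) {χ : C ⟶ B} (hχ : f ≫ χ = g)
    (hdeg : Hom.kerRank f = Hom.kerRank g) : IsIso χ := by
  have hχi := isIsogeny_of_isIsogeny_comp_eq hf hg hχ
  have hm := kerRank_eq_mul_of_comp_eq hf hg hχ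
  rw [← hdeg] at hm
  haveI := hf.2
  have hne : Hom.kerRank f ≠ 0 := (Hom.kerRank_pos f).ne'
  exact hχi.isIso_of_kerRank_eq_one ((mul_eq_left₀ hne).mp hm.symm)

/-! ## §3 Two isogenies of the same degree, the second killing the kernel of the first, are isomorphic under `A` -/

/-- **UNIQUENESS OF THE QUOTIENT BY DEGREE** ([MumfordAV1970] §7 Thm. 4, «`K = ker f`» determines `f : X → Y` up to isomorphism under `X`): for
isogenies `f : A ⟶ C`, `g : A ⟶ B` of the SAME degree with `g` killing `ker f` on points, there is an isomorphism `e : C ≅ B` of abelian varieties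
with `f ≫ e.hom = g`, and it is the unique factorisation. [cite: MumfordAV1970, §7 Thm. 4 (p. 72)] [cite: SGA1, Exp. VIII Thm. 5.2] -/
theorem IsIsogeny.exists_iso_comp_eq_of_kerRank_eq {f : A ⟶ C} {g : A ⟶ B} (hf : IsIsogeny f) (hg : IsIsogeny g)
    (hker : ∀ ⦃T : SchemeOver k⦄ (t : T ⟶ A.X), t ≫ f.hom.hom.hom = 1 → t ≫ g.hom.hom.hom = 1)
    (hdeg : Hom.kerRank f = Hom.kerRank g) :
    ∃ e : C ≅ B, f ≫ e.hom = g ∧ ∀ χ : C ⟶ B, f ≫ χ = g → χ = e.hom := by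
  obtain ⟨χ, hχ, huniq⟩ := hf.existsUnique_comp_eq_of_forall_comp_eq_one g hker
  haveI := isIso_of_comp_eq_of_kerRank_eq hf hg hχ hdeg
  exact ⟨asIso χ, hχ, fun χ' h' => huniq χ' h'⟩

/-- … and then EACH kills the other's kernel: if `f ≫ e.hom = g` with `e` an isomorphism, `t ≫ f = 1 ↔ t ≫ g = 1` on points.
[cite: MumfordAV1970, §7 Thm. 4 (p. 72)] -/
theorem comp_eq_one_iff_of_iso_comp_eq {f : A ⟶ C} {g : A ⟶ B} (e : C ≅ B) (he : f ≫ e.hom = g) {T : SchemeOver k} (t : T ⟶ A.X) :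
    t ≫ f.hom.hom.hom = 1 ↔ t ≫ g.hom.hom.hom = 1 := by
  refine ⟨fun ht => comp_eq_one_of_comp_eq he t ht, fun ht => ?_⟩
  have he' : g ≫ e.inv = f := by rw [← he, Category.assoc, e.hom_inv_id, Category.comp_id]
  exact comp_eq_one_of_comp_eq he' t ht

/-! ## §4 (ED. 2) Equivariance of the descended morphism

The factor `χ` through the isogeny `f` is compatible with any endomorphisms ∕ morphisms of triples that `f` and `g` intertwine — `f` is an
epimorphism of abelian varieties (★ `IsIsogeny.cancel_left`).  This is how the HEART transports `ι`, `λ`, level structures along `quot`∕`transl`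
(the shape of ★ `frobeniusTwist_comp_eq_comp_of_relFrobenius_comp_eq` for an arbitrary isogeny in place of `F_{A/k}`). -/

/-- **FUNCTORIALITY OF DESCENT THROUGH ISOGENIES**: given factorisations `f ≫ χ = g` and `f' ≫ χ' = g'` (with `f` an isogeny) and morphisms
`a : A ⟶ A'`, `c : C ⟶ C'`, `b : B ⟶ B'` intertwining them (`a ≫ f' = f ≫ c`, `a ≫ g' = g ≫ b`), the factors are intertwined: `c ≫ χ' = χ ≫ b`
(precompose with the epimorphism `f`). [cite: MumfordAV1970, §7 Thm. 4 (p. 72)] -/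
theorem IsIsogeny.comp_factor_eq_factor_comp {A' B' C' : AbelianVariety k} {f : A ⟶ C} (hf : IsIsogeny f) {g : A ⟶ B} {χ : C ⟶ B}
    (hχ : f ≫ χ = g) {f' : A' ⟶ C'} {g' : A' ⟶ B'} {χ' : C' ⟶ B'} (hχ' : f' ≫ χ' = g') {a : A ⟶ A'} {c : C ⟶ C'} {b : B ⟶ B'}
    (hc : a ≫ f' = f ≫ c) (hb : a ≫ g' = g ≫ b) : c ≫ χ' = χ ≫ b := by
  apply hf.cancel_left
  calc f ≫ c ≫ χ' = (a ≫ f') ≫ χ' := by rw [hc, Category.assoc]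
    _ = a ≫ g' := by rw [Category.assoc, hχ']
    _ = g ≫ b := hb
    _ = f ≫ χ ≫ b := by rw [← hχ, Category.assoc]

/-- **EQUIVARIANCE OF THE FACTOR** (one triple): if `f ≫ χ = g` with `f` an isogeny and endomorphisms `εA`, `εC`, `εB` of `A`, `C`, `B` satisfy
`εA ≫ f = f ≫ εC` and `εA ≫ g = g ≫ εB`, then `εC ≫ χ = χ ≫ εB` — e.g. `χ` commutes with `𝒪`-actions `ι_C`, `ι_B` intertwined by `f` and `g`.
[cite: MumfordAV1970, §7 Thm. 4 (p. 72)] -/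
theorem IsIsogeny.comp_factor_eq_factor_comp_of_endo {f : A ⟶ C} (hf : IsIsogeny f) {g : A ⟶ B} {χ : C ⟶ B} (hχ : f ≫ χ = g)
    {εA : A ⟶ A} {εC : C ⟶ C} {εB : B ⟶ B} (hC : εA ≫ f = f ≫ εC) (hB : εA ≫ g = g ≫ εB) : εC ≫ χ = χ ≫ εB :=
  hf.comp_factor_eq_factor_comp hχ hχ hC hB

/-- The recognition isomorphism is equivariant: with `e : C ≅ B`, `f ≫ e.hom = g`, intertwined endomorphisms satisfy `εC ≫ e.hom = e.hom ≫ εB` and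
`εB ≫ e.inv = e.inv ≫ εC`. [cite: MumfordAV1970, §7 Thm. 4 (p. 72)] -/
theorem IsIsogeny.comp_iso_eq_iso_comp_of_endo {f : A ⟶ C} (hf : IsIsogeny f) {g : A ⟶ B} (e : C ≅ B) (he : f ≫ e.hom = g)
    {εA : A ⟶ A} {εC : C ⟶ C} {εB : B ⟶ B} (hC : εA ≫ f = f ≫ εC) (hB : εA ≫ g = g ≫ εB) :
    εC ≫ e.hom = e.hom ≫ εB ∧ εB ≫ e.inv = e.inv ≫ εC := by
  have h1 : εC ≫ e.hom = e.hom ≫ εB := hf.comp_factor_eq_factor_comp_of_endo he hC hB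
  refine ⟨h1, ?_⟩
  rw [← cancel_mono e.hom, Category.assoc, Category.assoc, e.inv_hom_id, Category.comp_id, h1, ← Category.assoc, e.inv_hom_id,
    Category.id_comp]

end Literature.AlgebraicGeometry.Motives.AbelianVariety

end
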